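import Literature.Probability.LatticeModels.LocalPerturbationClusterExpansion
import HarnessLib

/-!
# Local perturbations of a finite-range dependent reference process: locality of `log Z`

`Literature/Probability/LatticeModels/`; sequel of `LocalPerturbationClusterExpansion` (the
Kotecký–Preiss logarithm `pertLogZ μ g R C` of the perturbed partition function of a local
perturbation `IsLocalPerturbation μ R 𝓕 g ε`, its cluster expansion
`log Z(C) = Σ_{𝒞 ⊆ 𝒫(C)} Φ^T(𝒞)` and the `O(ε)` pinned cluster sums).

**The surface correction** (`norm_pertLogZ_union_sub_le`): for DISJOINT cell sets `C₁, C₂` and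
`e ε (Δ+1)² ≤ 1/2`,

  `‖log Z(C₁ ∪ C₂) - log Z(C₁) - log Z(C₂)‖ ≤ #∂ · (Δ+1) · 2eε`,

where `∂ = {x ∈ C₁ : ∃ y ∈ C₂, R x y}` is the interface seen from `C₁`. Indeed the three cluster
expansions run over the families of polymers of `C₁ ∪ C₂`, of `C₁` and of `C₂`; the last two are
sub-sums of the first meeting only in the empty family, and a CLUSTER of polymers of `C₁ ∪ C₂`
which is neither inside `C₁` nor inside `C₂` contains either a polymer straddling the interface
(a connected set meeting both sides has an `R`-edge across it,
`exists_adj_of_isRConnected_subset_union`) or two incompatible polymers on the two sides; in both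
cases it touches a singleton `{x}`, `x ∈ ∂` (`exists_kpTouches_interface`), and the clusters pinned
at `{x}` weigh at most `(Δ+1) 2eε`. This is the locality ("`log Z` = bulk terms + boundary terms")
used to extract extensive constants scale by scale in multiscale expansions. Everything is proved.

## References

* R. Kotecký, D. Preiss, *Cluster expansion for abstract polymer models*, Comm. Math. Phys. 103
  (1986) 491–498, Theorem p. 492 with (2), (4). [KoteckyPreiss1986]
* S. Friedli, Y. Velenik, *Statistical Mechanics of Lattice Systems*, CUP (2017), §5.7.1.
  [FriedliVelenik2017]
-/

noncomputable section

open _root_.MeasureTheory _root_.ProbabilityTheory Finset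
open scoped BigOperators

namespace Literature.Probability.LatticeModels

variable {V : Type*}

/-! ### Locality of `log Z`: the surface correction -/

section Surface

variable [DecidableEq V] {Ω : Type*} {mΩ : MeasurableSpace Ω} {μ : Measure Ω}
  {R : V → V → Prop} [DecidableRel R] [Std.Symm R] {𝓕 : V → MeasurableSpace Ω} {g : V → Ω → ℂ}
  {ε : ℝ} {nbr : V → Finset V} {Δ : ℕ}

omit [DecidableRel R] [Std.Symm R] in
/-- A connected cell set meeting `C₁` and lying in `C₁ ∪ C₂` either lies in `C₁` or contains a
cell of `C₁` adjacent to a cell of `C₂`. [folklore] -/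
theorem exists_adj_of_isRConnected_subset_union {C₁ C₂ Y : Finset V} (hY : IsRConnected R Y)
    (hYU : Y ⊆ C₁ ∪ C₂) {a : V} (ha : a ∈ Y) (haC : a ∈ C₁) (hY2 : ¬ Y ⊆ C₁) :
    ∃ x ∈ Y, x ∈ C₁ ∧ ∃ y ∈ Y, y ∈ C₂ ∧ R x y := by
  obtain ⟨b, hbY, hbC⟩ := not_subset.1 hY2
  -- walk from `a` to `b` inside `Y`; the first exit from `C₁` is the wanted edge
  have key : ∀ w, Relation.ReflTransGen (fun x y => R x y ∧ x ∈ Y ∧ y ∈ Y) a w → w ∉ C₁ →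
      ∃ x ∈ Y, x ∈ C₁ ∧ ∃ y ∈ Y, y ∈ C₂ ∧ R x y := by
    intro w hw
    induction hw with
    | refl => exact fun h => absurd haC h
    | @tail u v _ huv ih =>
      intro hvC
      by_cases huC : u ∈ C₁
      · have hv2 : v ∈ C₂ := by
          rcases mem_union.1 (hYU huv.2.2) with h | h
          · exact absurd h hvC
          · exact h
        exact ⟨u, huv.2.1, huC, v, huv.2.2, hv2, huv.1⟩
      · exact ih huC
  exact key b (hY.2 a ha b hbY) hbC

omit [DecidableEq V] [DecidableRel R] [Std.Symm R] in
/-- The polymers of a smaller cell set are polymers of a larger one. [folklore] -/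
theorem rconnSubsets_mono {C C' : Finset V} (h : C ⊆ C') : rconnSubsets R C ⊆ rconnSubsets R C' :=
  fun _ hX => mem_rconnSubsets.2 ⟨(mem_rconnSubsets.1 hX).1.trans h, (mem_rconnSubsets.1 hX).2⟩

omit [DecidableRel R] [Std.Symm R] in
/-- Disjoint cell sets have no polymer in common. [folklore] -/
theorem rconnSubsets_inter_eq_empty {C₁ C₂ : Finset V} (hdisj : Disjoint C₁ C₂) :
    rconnSubsets R C₁ ∩ rconnSubsets R C₂ = ∅ := by
  refine eq_empty_of_forall_notMem fun X hX => ?_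
  obtain ⟨h1, h2⟩ := mem_inter.1 hX
  obtain ⟨hX1, hXc⟩ := mem_rconnSubsets.1 h1
  obtain ⟨p, hp⟩ := hXc.1
  exact Finset.disjoint_left.1 hdisj (hX1 hp) ((mem_rconnSubsets.1 h2).1 hp)

omit [DecidableRel R] in
/-- **Which clusters see the interface.** Let `C₁, C₂` be disjoint. A cluster of polymers of
`C₁ ∪ C₂` which is neither a family of polymers of `C₁` nor of `C₂` touches a singleton `{x}`
with `x ∈ C₁` adjacent to a cell of `C₂`. [folklore] -/
theorem exists_kpTouches_interface {C₁ C₂ : Finset V} (hdisj : Disjoint C₁ C₂)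
    {𝒞 : Finset (Finset V)} (h𝒞 : 𝒞 ⊆ rconnSubsets R (C₁ ∪ C₂))
    (h1 : ¬ 𝒞 ⊆ rconnSubsets R C₁) (h2 : ¬ 𝒞 ⊆ rconnSubsets R C₂)
    (hcl : IsPolymerCluster (GeomInc R) 𝒞) :
    ∃ x ∈ C₁, (∃ y ∈ C₂, R x y) ∧ KPTouches (GeomInc R) 𝒞 {x} := by
  classical
  have hR : ∀ x y, R x y → R y x := symm_of_inst
  -- a polymer straddling the interface gives the edge directly
  by_cases hstr : ∃ Y ∈ 𝒞, ¬ Y ⊆ C₁ ∧ ¬ Y ⊆ C₂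
  · obtain ⟨Y, hY𝒞, hY1, hY2⟩ := hstr
    obtain ⟨hYU, hYc⟩ := mem_rconnSubsets.1 (h𝒞 hY𝒞)
    -- `Y` meets `C₁` (else `Y ⊆ C₂`)
    obtain ⟨a, haY, haC⟩ : ∃ a ∈ Y, a ∈ C₁ := by
      by_contra hno
      push Not at hno
      exact hY2 fun q hq => (mem_union.1 (hYU hq)).resolve_left (hno q hq)
    obtain ⟨x, hxY, hxC, y, hyY, hyC, hxy⟩ :=
      exists_adj_of_isRConnected_subset_union hYc hYU haY haC hY1
    exact ⟨x, hxC, ⟨y, hyC, hxy⟩, Y, hY𝒞, Or.inr ⟨x, hxY, x, mem_singleton_self x, Or.inl rfl⟩⟩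
  · push Not at hstr
    -- every polymer lies in `C₁` or in `C₂`; both kinds occur; the cluster property links them
    set 𝒞₁ : Finset (Finset V) := 𝒞.filter fun Y => Y ⊆ C₁ with h𝒞₁
    have h𝒞₁sub : 𝒞₁ ⊆ 𝒞 := filter_subset _ _
    have h𝒞₁ne : 𝒞₁.Nonempty := by
      by_contra hno
      apply h2
      intro Y hY
      have hY1 : ¬ Y ⊆ C₁ := fun h => hno ⟨Y, mem_filter.2 ⟨hY, h⟩⟩
      have hY2 : Y ⊆ C₂ := by
        by_contra h'; exact hY1 (by by_contra h''; exact absurd (hstr Y hY h'') h')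
      exact mem_rconnSubsets.2 ⟨hY2, (mem_rconnSubsets.1 (h𝒞 hY)).2⟩
    have hrest : (𝒞 \ 𝒞₁).Nonempty := by
      by_contra hno
      apply h1
      intro Y hY
      have : Y ∈ 𝒞₁ := by
        by_contra h'
        exact hno ⟨Y, mem_sdiff.2 ⟨hY, h'⟩⟩
      exact mem_rconnSubsets.2 ⟨(mem_filter.1 this).2, (mem_rconnSubsets.1 (h𝒞 hY)).2⟩
    obtain ⟨Y₁, hY₁, Y₂, hY₂, hinc⟩ := hcl 𝒞₁ h𝒞₁sub h𝒞₁ne hrest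
    obtain ⟨hY₁𝒞, hY₁C⟩ := mem_filter.1 hY₁
    obtain ⟨hY₂𝒞, hY₂n⟩ := mem_sdiff.1 hY₂
    have hY₂C : Y₂ ⊆ C₂ := by
      have hn1 : ¬ Y₂ ⊆ C₁ := fun h => hY₂n (mem_filter.2 ⟨hY₂𝒞, h⟩)
      by_contra h'; exact hn1 (by by_contra h''; exact absurd (hstr Y₂ hY₂𝒞 h'') h')
    have hY₂ne : Y₂.Nonempty := (mem_rconnSubsets.1 (h𝒞 hY₂𝒞)).2.1
    rcases hinc with heq | ⟨x, hx, y, hy, hxy⟩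
    · -- equal polymers would lie in `C₁ ∩ C₂ = ∅`
      exfalso
      obtain ⟨q, hq⟩ := hY₂ne
      exact Finset.disjoint_left.1 hdisj (hY₁C (heq ▸ hq)) (hY₂C hq)
    · rcases hxy with rfl | hxy
      · exact absurd (hY₂C hy) (Finset.disjoint_left.1 hdisj (hY₁C hx))
      · exact ⟨x, hY₁C hx, ⟨y, hY₂C hy, hxy⟩, Y₁, hY₁𝒞,
          Or.inr ⟨x, hx, x, mem_singleton_self x, Or.inl rfl⟩⟩

/-- **Locality of `log Z` (the surface correction).** For disjoint cell sets `C₁, C₂` and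
`e ε (Δ+1)² ≤ 1/2`:
`‖log Z(C₁ ∪ C₂) - log Z(C₁) - log Z(C₂)‖ ≤ #∂ · (Δ+1) 2eε`, where `∂` is the set of cells of `C₁`
adjacent to a cell of `C₂` — only clusters straddling the interface contribute ([KP86, (2)] in
the two volumes; the straddling clusters are pinned at `∂`, `sum_norm_truncatedWeight_touching_le`).
[cite: KoteckyPreiss1986, Theorem p. 492, (2) and (4); FriedliVelenik2017, §5.7.1] -/
theorem norm_pertLogZ_union_sub_le [IsProbabilityMeasure μ] (hΔ : ∀ x, (nbr x).card ≤ Δ)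
    (hnbr : ∀ x y, R x y → y ∈ nbr x) (h : IsLocalPerturbation μ R 𝓕 g ε)
    (hsmall : Real.exp 1 * ε * ((Δ : ℝ) + 1) ^ 2 ≤ 1 / 2) {C₁ C₂ : Finset V}
    (hdisj : Disjoint C₁ C₂) :
    ‖pertLogZ μ g R (C₁ ∪ C₂) - pertLogZ μ g R C₁ - pertLogZ μ g R C₂‖ ≤
      (C₁.filter fun x => ∃ y ∈ C₂, R x y).card * ((Δ : ℝ) + 1) * (2 * (Real.exp 1 * ε)) := by
  classical
  set L := rconnSubsets R (C₁ ∪ C₂) with hL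
  set L₁ := rconnSubsets R C₁ with hL₁
  set L₂ := rconnSubsets R C₂ with hL₂
  set Φ : Finset (Finset V) → ℂ := truncatedWeight (GeomInc R) (connActivity R μ g) with hΦ
  set bd : Finset V := C₁.filter fun x => ∃ y ∈ C₂, R x y with hbd
  have hL₁L : L₁ ⊆ L := rconnSubsets_mono subset_union_left
  have hL₂L : L₂ ⊆ L := rconnSubsets_mono subset_union_right
  -- the three expansions
  rw [pertLogZ_eq_sum_truncatedWeight, pertLogZ_eq_sum_truncatedWeight,
    pertLogZ_eq_sum_truncatedWeight]
  -- `Σ_{L.powerset} = Σ_{L₁.ps ∪ L₂.ps} + Σ_{rest}` and `Σ_{L₁.ps ∪ L₂.ps} = Σ_{L₁.ps} + Σ_{L₂.ps}`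
  set rest : Finset (Finset (Finset V)) := L.powerset \ (L₁.powerset ∪ L₂.powerset) with hrest
  have hsub : L₁.powerset ∪ L₂.powerset ⊆ L.powerset :=
    union_subset (powerset_mono.2 hL₁L) (powerset_mono.2 hL₂L)
  have hsplit : ∑ 𝒞 ∈ L.powerset, Φ 𝒞 =
      (∑ 𝒞 ∈ L₁.powerset ∪ L₂.powerset, Φ 𝒞) + ∑ 𝒞 ∈ rest, Φ 𝒞 := by
    rw [← sum_union (disjoint_sdiff), union_sdiff_of_subset hsub]
  have hinter : L₁.powerset ∩ L₂.powerset = {∅} := by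
    ext 𝒞
    simp only [mem_inter, mem_powerset, mem_singleton]
    constructor
    · rintro ⟨h1', h2'⟩
      refine eq_empty_of_forall_notMem fun Y hY => ?_
      have : Y ∈ L₁ ∩ L₂ := mem_inter.2 ⟨h1' hY, h2' hY⟩
      rw [rconnSubsets_inter_eq_empty hdisj] at this
      simp at this
    · rintro rfl; exact ⟨empty_subset _, empty_subset _⟩
  have hunion : ∑ 𝒞 ∈ L₁.powerset ∪ L₂.powerset, Φ 𝒞 =
      (∑ 𝒞 ∈ L₁.powerset, Φ 𝒞) + ∑ 𝒞 ∈ L₂.powerset, Φ 𝒞 := by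
    have := sum_union_inter (s₁ := L₁.powerset) (s₂ := L₂.powerset) (f := Φ)
    rw [hinter, sum_singleton, hΦ, truncatedWeight_empty, add_zero] at this
    exact this
  rw [hsplit, hunion]
  have hring : (∑ 𝒞 ∈ L₁.powerset, Φ 𝒞) + (∑ 𝒞 ∈ L₂.powerset, Φ 𝒞) + (∑ 𝒞 ∈ rest, Φ 𝒞) -
      (∑ 𝒞 ∈ L₁.powerset, Φ 𝒞) - (∑ 𝒞 ∈ L₂.powerset, Φ 𝒞) = ∑ 𝒞 ∈ rest, Φ 𝒞 := by ring
  rw [hring]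
  -- each nonzero term of `rest` is a cluster straddling the interface, pinned at `bd`
  have hKP : IsKPVolume (GeomInc R) (connActivity R μ g) (fun X => (X.card : ℝ)) L :=
    isKPVolume_connActivity hΔ hnbr h hsmall L
  refine (norm_sum_le _ _).trans ?_
  calc ∑ 𝒞 ∈ rest, ‖Φ 𝒞‖
      ≤ ∑ 𝒞 ∈ rest, ∑ x ∈ bd with KPTouches (GeomInc R) 𝒞 {x}, ‖Φ 𝒞‖ := by
        refine sum_le_sum fun 𝒞 h𝒞 => ?_
        obtain ⟨h𝒞L, h𝒞n⟩ := mem_sdiff.1 h𝒞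
        have h𝒞L' : 𝒞 ⊆ L := mem_powerset.1 h𝒞L
        by_cases hcl : IsPolymerCluster (GeomInc R) 𝒞
        · have hn1 : ¬ 𝒞 ⊆ L₁ := fun h' => h𝒞n (mem_union_left _ (mem_powerset.2 h'))
          have hn2 : ¬ 𝒞 ⊆ L₂ := fun h' => h𝒞n (mem_union_right _ (mem_powerset.2 h'))
          obtain ⟨x, hxC, hxy, hx⟩ := exists_kpTouches_interface hdisj h𝒞L' hn1 hn2 hcl
          have hmem : x ∈ bd.filter fun x => KPTouches (GeomInc R) 𝒞 {x} :=
            mem_filter.2 ⟨mem_filter.2 ⟨hxC, hxy⟩, hx⟩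
          calc ‖Φ 𝒞‖ = ∑ q ∈ ({x} : Finset V), ‖Φ 𝒞‖ := by simp
            _ ≤ _ := sum_le_sum_of_subset_of_nonneg (by simpa using hmem) fun _ _ _ => norm_nonneg _
        · rw [hΦ, truncatedWeight_eq_zero_of_kp hKP h𝒞L' hcl, norm_zero]
          exact sum_nonneg fun _ _ => le_rfl
    _ ≤ ∑ 𝒞 ∈ L.powerset, ∑ x ∈ bd with KPTouches (GeomInc R) 𝒞 {x}, ‖Φ 𝒞‖ :=
        sum_le_sum_of_subset_of_nonneg sdiff_subset fun _ _ _ => sum_nonneg fun _ _ => norm_nonneg _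
    _ = ∑ x ∈ bd, ∑ 𝒞 ∈ L.powerset with KPTouches (GeomInc R) 𝒞 {x}, ‖Φ 𝒞‖ := by
        rw [sum_comm' (t' := bd) (s' := fun x => L.powerset.filter fun 𝒞 => KPTouches (GeomInc R) 𝒞 {x})]
        intro 𝒞 x
        simp only [mem_filter]
        tauto
    _ ≤ ∑ x ∈ bd, (({x} : Finset V).card : ℝ) * ((Δ : ℝ) + 1) * (2 * (Real.exp 1 * ε)) :=
        sum_le_sum fun x _ => sum_norm_truncatedWeight_touching_le hΔ hnbr h hsmall (C₁ ∪ C₂) {x}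
    _ = bd.card * ((Δ : ℝ) + 1) * (2 * (Real.exp 1 * ε)) := by
        simp only [card_singleton, Nat.cast_one, one_mul, sum_const, nsmul_eq_mul]
        ring

end Surface

end Literature.Probability.LatticeModels
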